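import Literature.Probability.FitznerVanDerHofstad2017.NobleBoundsN1Summation
import Literature.Probability.FitznerVanDerHofstad2017.NobleWeightedBlocks
import Literature.Probability.FitznerVanDerHofstad2017.NobleSymmetry
import HarnessLib

/-!
# [FvdH17] Lemma 5.3 (BoundXiIotaOne-1), summation half WITH the trivial initial term, on the
`ι`-averaged vector `P⃗^ι` — PROVED

Source: R. Fitzner, R. van der Hofstad, *Mean-field behavior for nearest-neighbor percolation in `d > 10`*,
Electron. J. Probab. **22** (2017) no. 43 [FvdH17]; extended version arXiv:1506.07977v2: §5.1 "Elements of the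
bounds" (p. 49, TeX l.9364) "`(P⃗^ι)_b = (1/2d)[δ_{0,b} + Σ_{ι,x,y} P^{ι,b}(x,y)]`"; Lemma 5.3 first display
(p. 50, `BoundXiIotaOne-1`) "`Σ_x Ξ^{(1),ι}_p(x) ≤ P⃗^ι Ā^ι P⃗^E`"; and its proof in §6.1 (p. 59, TeX l.10075–10081,
label `lemmapercboundXiiota1-1-step0`):

  "We define `a = d_{C̃₀}(u,w)` […] and `b = d_{C̃₁}(t,z)` and show that
  `Ξ^{(1),ι}_p(x) ≤ Σ_{a,b=0}^{2} Σ_{u,κ,w,z,t} (δ_{a,0} δ_{ι,κ} 𝟙{u=w=0} + P^{ι,a}(u,w)) Ā^{κ,a,b}(u,w,t,z) P^{E,b}(t−x,z−x)`. (6.x)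
  Once this is established, the bound (BoundXiIotaOne-1) follows by repeating the steps leading to (6.5)."
  (Figure caption, l.10069: "the last [diagram] gives rise to the `δ_{a,0} δ_{ι,κ} 𝟙{u=w=0}` term.")

What is proved here (kernel-checked; no cited hypothesis; any letter table `L : Letters d`, any `d`):
* `sum_kdeltaPref`: `Σ_ι δ_{0,a} δ_{κ,ι} δ_{0,u} δ_{0,w} = δ_{0,a} δ_{0,u} δ_{0,w}` (`trivPiece`), i.e. summing the
  per-direction pointwise bound (6.x) over `ι` turns the Kronecker initial term into a genuine, `κ`-independent left
  piece; `vecP_piotaFull`: the pair-sum of the full left piece `trivPiece + Σ_ι P^{ι,·}` is `δ_{0,b} + Σ_{ι,x,y} P^{ι,b}(x,y)`,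
  so that `(1/2d) · vecP (piotaFull L) = vecPiota L` (`vecPiota_eq_invTwoD_mul_vecP_piotaFull`; `vecPiota` is the
  typed `P⃗^ι` of `NobleWeightedBlocks`, trivial term included);
* MAIN `invTwoD_mul_sum_tsum_le_vecPiota_matAbarIota_vecPE`: if a family `Ξ^ι : ℤ^d → [0,∞]` obeys (6.x) for every
  `ι` and `x`, then `(1/2d) Σ_ι Σ_x Ξ^ι(x) ≤ P⃗^ι Ā^ι P⃗^E` (`vecPiota L ᵥ* matAbarIota L ⬝ᵥ vecPE L`) — the
  abstract summation (6.5) of `BlockSummation` / `NobleBoundsN1Summation` applied to `Σ_ι Ξ^ι`;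
* `tsum_le_vecPiota_matAbarIota_vecPE_of_symm`: if moreover `Σ_x Ξ^ι(x)` does not depend on `ι`, then for each fixed
  `ι₀`, `Σ_x Ξ^{ι₀}(x) ≤ P⃗^ι Ā^ι P⃗^E` — the printed (BoundXiIotaOne-1) shape;
* the instance `tsum_ofReal_nobleXiIotaN_le_vecPiota_matAbarIota_vecPE` for `Ξ^ι = Ξ^{(N),ι}_p` (`ι`-independence
  of `Σ_x Ξ^{(N),ι}_p(x)` is the lattice symmetry (4.28), `NobleSymmetry`; here in `[0,∞]`-currency,
  `tsum_ofReal_nobleXiIotaN_exch`).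

Reading note (Q-N76-TRIV of the b2b-lace packet).  The fixed-direction summation lemma
`NobleBoundsN1Summation.tsum_le_vecPiota_matAbarIota_vecPE` bounds `Σ_x Ξ` by `vecP (blockPiota L ι₀) ᵥ* Ā^ι ⬝ P⃗^E`
from an `x`-space bound WITHOUT the trivial initial term; that vector is NOT the printed `P⃗^ι`: (6.x) carries the
extra term `δ_{a,0} δ_{ι,κ} 𝟙{u=w=0}` whose `δ_{ι,κ}` selects ONE of the `2d` directions of `(Ā^ι)_{0,b} =
sup Σ_{κ,x} Ā^{κ,0,b}`, and the factor `1/2d` in `P⃗^ι` is earned only after summing (6.x) over `ι` — which is what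
the present module does.  The pointwise bound (6.x) itself (for the percolation letters) is NOT asserted here.
No numerical value and no dimension enter.
-/

noncomputable section

namespace Literature.Probability.FitznerVanDerHofstad2017.NobleBlocks

open Literature.Probability.LatticeModels Literature.Probability.Percolation
open Literature.Probability.FitznerVanDerHofstad2017.BlockSummation
open Literature.Barriers.CriticalPhenomena (nobleXiIotaN nobleXiIotaN_nonneg)
open scoped BigOperators ENNReal Matrix

local notation "𝐞" => Literature.Probability.Percolation.stepVec

variable {d : ℕ}

/-! ## The trivial initial piece and the full left piece -/

/-- The trivial initial piece `δ_{0,a} 𝟙{u=0} 𝟙{w=0}` of (6.x) after the `ι`-sum (the point diagram: `u = w = 0`,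
length class `a = 0`). [cite: FitznerVanDerHofstad2017, §6.1 (6.x) `lemmapercboundXiiota1-1-step0` (arXiv:1506.07977v2 p. 59)] -/
def trivPiece (a : Fin 3) (u w : Site d) : ℝ≥0∞ := (if a = 0 then 1 else 0) * kd 0 u * kd 0 w

/-- `Σ_ι δ_{0,a} δ_{κ,ι} δ_{0,u} δ_{0,w} = δ_{0,a} δ_{0,u} δ_{0,w}`: exactly one direction `ι` equals `κ`. [folklore] -/
theorem sum_kdeltaPref (κ : Fin d × Bool) (a : Fin 3) (u w : Site d) :
    ∑ ι : Fin d × Bool, kdeltaPref ι κ a u w = trivPiece a u w := by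
  have h : ∀ ι, kdeltaPref ι κ a u w = if κ = ι then trivPiece a u w else 0 := fun ι => by
    unfold kdeltaPref trivPiece
    split_ifs <;> simp
  simp_rw [h, Finset.sum_ite_eq, Finset.mem_univ, if_true]

/-- `Σ_y δ_{x,y} = 1`. [folklore] -/
theorem tsum_kd (x : Site d) : ∑' y, kd x y = 1 := by
  have h : ∀ y, kd x y = if y = x then (1 : ℝ≥0∞) else 0 := fun y => by
    by_cases hy : y = x
    · subst hy; simp
    · rw [kd_of_ne (Ne.symm hy), if_neg hy]
  simp_rw [h]
  exact tsum_ite_eq x (fun _ => (1 : ℝ≥0∞))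

/-- `Σ_{u,w} δ_{0,a} 𝟙{u=0} 𝟙{w=0} = δ_{0,a}`. [folklore] -/
theorem vecP_trivPiece (a : Fin 3) : vecP (trivPiece (d := d)) a = if a = 0 then 1 else 0 := by
  simp only [vecP, pairSum, trivPiece, mul_assoc, ENNReal.tsum_mul_left, tsum_kd, mul_one]

/-- The full left piece of (6.x) summed over `ι`: `δ_{0,a} 𝟙{u=0} 𝟙{w=0} + Σ_ι P^{ι,a}(u,w)`.
[cite: FitznerVanDerHofstad2017, §6.1 (6.x) (arXiv:1506.07977v2 p. 59); §5.1 display for `(P⃗^ι)_b` (p. 49)] -/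
def piotaFull (L : Letters d) (a : Fin 3) (u w : Site d) : ℝ≥0∞ :=
  trivPiece a u w + ∑ ι : Fin d × Bool, blockPiota L ι a u w

/-- `Σ_{x,y} piotaFull^b(x,y) = δ_{0,b} + Σ_{ι,x,y} P^{ι,b}(x,y)`. [cite: FitznerVanDerHofstad2017, §5.1 display for `(P⃗^ι)_b` (arXiv:1506.07977v2 p. 49)] -/
theorem vecP_piotaFull (L : Letters d) (b : Fin 3) :
    vecP (piotaFull L) b = (if b = 0 then 1 else 0) + vecPiotaSum L b := by
  rw [← vecP_trivPiece b]
  simp only [vecP, pairSum, piotaFull, vecPiotaSum]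
  have h : ∀ x : Site d, ∑' y, (trivPiece b x y + ∑ ι : Fin d × Bool, blockPiota L ι b x y)
      = ∑' y, trivPiece b x y + ∑' y, ∑ ι : Fin d × Bool, blockPiota L ι b x y := fun x => ENNReal.tsum_add
  simp_rw [h]
  exact ENNReal.tsum_add

/-- **`P⃗^ι = (1/2d) · vecP (piotaFull)`**: the typed `vecPiota` of `NobleWeightedBlocks` (trivial term included)
is the `1/2d`-multiple of the pair-sum vector of the full left piece.
[cite: FitznerVanDerHofstad2017, §5.1 display for `(P⃗^ι)_b` (arXiv:1506.07977v2 p. 49)] -/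
theorem vecPiota_eq_invTwoD_mul_vecP_piotaFull (L : Letters d) (b : Fin 3) :
    vecPiota L b = invTwoD d * vecP (piotaFull L) b := by
  rw [vecP_piotaFull]
  rfl

/-- Scaling the bilinear form: `(1/2d) · (vecP piotaFull ᵥ* M ⬝ v) = P⃗^ι ᵥ* M ⬝ v`. [folklore] -/
theorem invTwoD_mul_vecP_piotaFull_vecMul_dotProduct (L : Letters d) (M : Matrix (Fin 3) (Fin 3) ℝ≥0∞)
    (v : Fin 3 → ℝ≥0∞) :
    invTwoD d * (vecP (piotaFull L) ᵥ* M ⬝ᵥ v) = vecPiota L ᵥ* M ⬝ᵥ v := by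
  rw [← sum_sum_mul_mul_eq_vecMul_dotProduct, ← sum_sum_mul_mul_eq_vecMul_dotProduct, Finset.mul_sum]
  refine Finset.sum_congr rfl fun a _ => ?_
  rw [Finset.mul_sum]
  refine Finset.sum_congr rfl fun b _ => ?_
  rw [vecPiota_eq_invTwoD_mul_vecP_piotaFull]
  simp only [mul_assoc]

/-! ## The averaged summation -/

/-- Summing (6.x) over the direction `ι`: the `ι`-summed family obeys the `x`-space bound of shape (6.4) with the
full left piece `piotaFull L`. [cite: FitznerVanDerHofstad2017, §6.1 (6.x) and "repeating the steps leading to (6.5)" (arXiv:1506.07977v2 p. 59)] -/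
theorem sum_le_xSpaceBound_piotaFull (L : Letters d) (Ξι : Fin d × Bool → Site d → ℝ≥0∞)
    (hΞ : ∀ ι x, Ξι ι x ≤ ∑' u, ∑' w, ∑' t, ∑' z, ∑ κ : Fin d × Bool, ∑ a : Fin 3, ∑ b : Fin 3,
      (kdeltaPref ι κ a u w + blockPiota L ι a u w) * blockAbar L κ a b u w t z * blockPE L b (t - x) (z - x))
    (x : Site d) :
    ∑ ι : Fin d × Bool, Ξι ι x ≤ ∑' u, ∑' w, ∑' t, ∑' z, ∑ κ : Fin d × Bool, ∑ a : Fin 3, ∑ b : Fin 3,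
      piotaFull L a u w * blockAbar L κ a b u w t z * blockPE L b (t - x) (z - x) := by
  calc ∑ ι : Fin d × Bool, Ξι ι x
      ≤ ∑ ι : Fin d × Bool, ∑' u, ∑' w, ∑' t, ∑' z, ∑ κ : Fin d × Bool, ∑ a : Fin 3, ∑ b : Fin 3,
          (kdeltaPref ι κ a u w + blockPiota L ι a u w) * blockAbar L κ a b u w t z * blockPE L b (t - x) (z - x) :=
        Finset.sum_le_sum fun ι _ => hΞ ι x
    _ = ∑' u, ∑' w, ∑' t, ∑' z, ∑ κ : Fin d × Bool, ∑ a : Fin 3, ∑ b : Fin 3,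
          piotaFull L a u w * blockAbar L κ a b u w t z * blockPE L b (t - x) (z - x) := by
        rw [← tsum_finsetSum]
        refine tsum_congr fun u => ?_
        rw [← tsum_finsetSum]
        refine tsum_congr fun w => ?_
        rw [← tsum_finsetSum]
        refine tsum_congr fun t => ?_
        rw [← tsum_finsetSum]
        refine tsum_congr fun z => ?_
        rw [Finset.sum_comm]
        refine Finset.sum_congr rfl fun κ _ => ?_
        rw [Finset.sum_comm]
        refine Finset.sum_congr rfl fun a _ => ?_
        rw [Finset.sum_comm]
        refine Finset.sum_congr rfl fun b _ => ?_
        rw [← Finset.sum_mul, ← Finset.sum_mul, Finset.sum_add_distrib, sum_kdeltaPref]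
        rfl

/-- **[FvdH17] Lemma 5.3 (BoundXiIotaOne-1), summation half, `ι`-averaged — PROVED.**  If a family
`Ξ^ι : ℤ^d → [0,∞]`, `ι` a direction, obeys the pointwise bound (6.x)
`Ξ^ι(x) ≤ Σ_{u,w,t,z} Σ_κ Σ_{a,b} (δ_{a,0} δ_{ι,κ} 𝟙{u=w=0} + P^{ι,a}(u,w)) Ā^{κ,a,b}(u,w,t,z) P^{E,b}(t−x,z−x)` for every
`ι, x`, then `(1/2d) Σ_ι Σ_x Ξ^ι(x) ≤ P⃗^ι Ā^ι P⃗^E` with the printed `P⃗^ι` (trivial term and `1/2d` included).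
[cite: FitznerVanDerHofstad2017, Lemma 5.3 (BoundXiIotaOne-1) (arXiv:1506.07977v2 p. 50); §6.1 (6.x), (6.5) (pp. 58–59); §5.1 `(P⃗^ι)_b` (p. 49)] -/
theorem invTwoD_mul_sum_tsum_le_vecPiota_matAbarIota_vecPE (L : Letters d)
    (Ξι : Fin d × Bool → Site d → ℝ≥0∞)
    (hΞ : ∀ ι x, Ξι ι x ≤ ∑' u, ∑' w, ∑' t, ∑' z, ∑ κ : Fin d × Bool, ∑ a : Fin 3, ∑ b : Fin 3,
      (kdeltaPref ι κ a u w + blockPiota L ι a u w) * blockAbar L κ a b u w t z * blockPE L b (t - x) (z - x)) :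
    invTwoD d * ∑ ι : Fin d × Bool, ∑' x, Ξι ι x ≤ vecPiota L ᵥ* matAbarIota L ⬝ᵥ vecPE L := by
  have h2 : ∑' x, ∑ ι : Fin d × Bool, Ξι ι x ≤ vecP (piotaFull L) ᵥ* matAbarIota L ⬝ᵥ vecPE L :=
    tsum_le_vecP_vecMul_matAbarIota_dotProduct_vecPE L (piotaFull L) (fun x => ∑ ι : Fin d × Bool, Ξι ι x)
      (sum_le_xSpaceBound_piotaFull L Ξι hΞ)
  rw [← tsum_finsetSum, ← invTwoD_mul_vecP_piotaFull_vecMul_dotProduct L (matAbarIota L) (vecPE L)]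
  gcongr

/-- `(1/2d) · (2d · c) = c` in `[0,∞]` (`d ≠ 0`). [folklore] -/
theorem invTwoD_mul_card_mul (hd : d ≠ 0) (c : ℝ≥0∞) :
    invTwoD d * ((Fintype.card (Fin d × Bool) : ℝ≥0∞) * c) = c := by
  have hcard : (Fintype.card (Fin d × Bool) : ℝ≥0∞) = 2 * (d : ℝ≥0∞) := by
    rw [Fintype.card_prod, Fintype.card_fin, Fintype.card_bool]
    push_cast
    ring
  have h0 : (2 : ℝ≥0∞) * (d : ℝ≥0∞) ≠ 0 :=
    mul_ne_zero two_ne_zero (by exact_mod_cast hd)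
  have htop : (2 : ℝ≥0∞) * (d : ℝ≥0∞) ≠ ⊤ := ENNReal.mul_ne_top ENNReal.ofNat_ne_top (ENNReal.natCast_ne_top d)
  rw [hcard, ← mul_assoc, invTwoD, ENNReal.inv_mul_cancel h0 htop, one_mul]

/-- **[FvdH17] Lemma 5.3 (BoundXiIotaOne-1), summation half, fixed direction under symmetry — PROVED.**
If, in addition to (6.x), the sums `Σ_x Ξ^ι(x)` do not depend on the direction `ι`, then for every `ι₀`,
`Σ_x Ξ^{ι₀}(x) ≤ P⃗^ι Ā^ι P⃗^E` (the printed shape).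
[cite: FitznerVanDerHofstad2017, Lemma 5.3 (BoundXiIotaOne-1) (arXiv:1506.07977v2 p. 50); §6.1 (p. 59)] -/
theorem tsum_le_vecPiota_matAbarIota_vecPE_of_symm (L : Letters d) (Ξι : Fin d × Bool → Site d → ℝ≥0∞)
    (hΞ : ∀ ι x, Ξι ι x ≤ ∑' u, ∑' w, ∑' t, ∑' z, ∑ κ : Fin d × Bool, ∑ a : Fin 3, ∑ b : Fin 3,
      (kdeltaPref ι κ a u w + blockPiota L ι a u w) * blockAbar L κ a b u w t z * blockPE L b (t - x) (z - x))
    (ι₀ : Fin d × Bool) (hsym : ∀ ι, ∑' x, Ξι ι x = ∑' x, Ξι ι₀ x) :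
    ∑' x, Ξι ι₀ x ≤ vecPiota L ᵥ* matAbarIota L ⬝ᵥ vecPE L := by
  have hd : d ≠ 0 := Nat.pos_iff_ne_zero.1 ι₀.1.pos
  have h := invTwoD_mul_sum_tsum_le_vecPiota_matAbarIota_vecPE L Ξι hΞ
  simp_rw [hsym, Finset.sum_const, Finset.card_univ, nsmul_eq_mul] at h
  rwa [invTwoD_mul_card_mul hd] at h

/-! ## Instance: the NoBLE coefficients `Ξ^{(N),ι}_p` -/

/-- `Σ_x Ξ^{(N),ι}_p(x) = Σ_x Ξ^{(N),κ}_p(x)` in `[0,∞]`-currency (lattice symmetry; the real-valued statement is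
`NobleSymmetry.nobleXiIotaN_tsum_exch`). [cite: FitznerVanDerHofstad2017, §3.5 (last display) (arXiv:1506.07977v2 p. 30)] -/
theorem tsum_ofReal_nobleXiIotaN_exch (p : unitInterval) (N : ℕ) (ι κ : Fin d × Bool) :
    ∑' x, ENNReal.ofReal (nobleXiIotaN d p (𝐞 ι) N x) = ∑' x, ENNReal.ofReal (nobleXiIotaN d p (𝐞 κ) N x) := by
  obtain ⟨π, ε, h⟩ := exists_signedPerm_stepVec ι κ
  rw [← h, ← zdSignedPermIso_apply, ← (zdSignedPermIso π ε).toEquiv.tsum_eq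
    (fun x => ENNReal.ofReal (nobleXiIotaN d p (zdSignedPermIso π ε (𝐞 ι)) N x))]
  exact tsum_congr fun x =>
    congrArg ENNReal.ofReal (nobleXiIotaN_relabel _ (zdSignedPermIso_sub π ε) p _ N x).symm

/-- **[FvdH17] Lemma 5.3 (BoundXiIotaOne-1) for `Ξ^{(N),ι}_p`, summation half — PROVED** (printed for `N = 1`):
if `Ξ^{(N),ι}_p` obeys the pointwise bound (6.x) for every direction `ι` (on a letter table `L`), then for every
`ι₀`, `Σ_x Ξ^{(N),ι₀}_p(x) ≤ P⃗^ι Ā^ι P⃗^E` in `[0,∞]` (the `ι`-average is removed by the lattice symmetry).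
[cite: FitznerVanDerHofstad2017, Lemma 5.3 (BoundXiIotaOne-1) (arXiv:1506.07977v2 p. 50); §6.1 (6.x) (p. 59); §3.5 (p. 30)] -/
theorem tsum_ofReal_nobleXiIotaN_le_vecPiota_matAbarIota_vecPE (L : Letters d) (p : unitInterval) (N : ℕ)
    (hΞ : ∀ ι x, ENNReal.ofReal (nobleXiIotaN d p (𝐞 ι) N x)
      ≤ ∑' u, ∑' w, ∑' t, ∑' z, ∑ κ : Fin d × Bool, ∑ a : Fin 3, ∑ b : Fin 3,
        (kdeltaPref ι κ a u w + blockPiota L ι a u w) * blockAbar L κ a b u w t z * blockPE L b (t - x) (z - x))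
    (ι₀ : Fin d × Bool) :
    ∑' x, ENNReal.ofReal (nobleXiIotaN d p (𝐞 ι₀) N x) ≤ vecPiota L ᵥ* matAbarIota L ⬝ᵥ vecPE L :=
  tsum_le_vecPiota_matAbarIota_vecPE_of_symm L (fun ι x => ENNReal.ofReal (nobleXiIotaN d p (𝐞 ι) N x)) hΞ ι₀
    fun ι => tsum_ofReal_nobleXiIotaN_exch p N ι ι₀

end Literature.Probability.FitznerVanDerHofstad2017.NobleBlocks

end
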